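import Summits.BirchSwinnertonDyer.BirchSwinnertonDyer.Theorems.SylvesterTwoHeegnerIndexCoupledTelescopeReflectionFramePoint
import Summits.BirchSwinnertonDyer.BirchSwinnertonDyer.Theorems.SylvesterTwoHeegnerIndexCoupledTelescopeReflectionChiComponent
import Summits.BirchSwinnertonDyer.BirchSwinnertonDyer.Theorems.SylvesterTwoHeegnerIndexCoupledTelescopeClassSystem
import Literature.NumberTheory.EllipticCurves.KolyvaginChiComponent
import HarnessLib

/-!
# The COUPLED Cassels–Tate telescope, LII: THE ROWS' KOLYVAGIN CLASSES ARE ADMISSIBLE — RESIDUE c v3 l.81/82 for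
# `c_A(n)`, `c_B(n)` (`n ≠ 1`) and the rows' `Adm_X` = `𝒪`-lines of σ-eigenclasses (crux `UpperOffV0HSYPlus`,
# stmt-BirchSwinnertonDyer-19804; plan (B) SIGNS, file B-III (IIIb) = B-III/B-IV instantiated on the class system)

Gross 1991 Prop. 5.4 in Hu–Shu–Yin's CM frame, assembled on the class system of `…CoupledTelescopeClassSystem` (S4b-1):
for `n ∈ KolSupp Kol`, with `Pt n = κ₉⁻¹ ιe_n(D_{l(n)} y_n)`, `A_n = E₉(K̄)^{N_n}` (`N_n = Gal(K̄/emb K[9pn])`) and the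
twisted traces `ψ_B(Σᵢ ρ_{tᵢ}(tᵢ Pt n))`, `ψ_A(Σᵢ ρ²_{tᵢ}(tᵢ Pt n))`, the classes `c_A(n)`, `c_B(n)` (`n ≠ 1`) lie in
`Adm_X := {x | ∃ y, (∃ ε, σ_* y = ε • y) ∧ x ∈ closure {y, w_X y} ∧ y ∈ closure {x, w_X x}}` (B-V):
(IIIa) reflection input + (F★) three-case law (`R := ρ` / `ρ ∘ ρ`; `A_n` Γ_K/ρ/scaling/τ̃-stable) + (B-IV) membership.
* ★★ `kolyvaginClasses_mem_admLines_sylvesterPair` (binders = S4b-1's ★ + `hσgal`, `φ_X`/`fn_X`, `c`; `c_B(1)` is B-V′).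
Theorems only (no definition / named fact / instance / notation); nothing asserted on 19804; no stub closed;
X12.CMAtTwo NOT proved; BSD not claimed for any curve.  Sources: [GrossLMS1991] §4, Prop. 5.3, Prop. 5.4;
[McCallumLMS1991] §4 (4)–(6), §5; [HuShuYin2019] §1 p. 4, §2 p. 8, §4.1.
-/

set_option linter.dupNamespace false -- Summits modules are `Summit.<Summit>.<Problem>…` by design
set_option autoImplicit false

noncomputable section

open scoped Classical

namespace Summit.BirchSwinnertonDyer.BirchSwinnertonDyer.Theorems.SylvesterTwoCMFlip

open WeierstrassCurve Field NumberField IsDedekindDomain Finset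
open Literature.NumberTheory.EllipticCurves Literature.NumberTheory.GaloisRepresentations
  Literature.NumberTheory.EllipticCurves.ModularForms
  Literature.NumberTheory.EllipticCurves.HuShuYin2019
  Literature.NumberTheory.EllipticCurves.KolyvaginCocycle
  Literature.NumberTheory.EllipticCurves.KolyvaginDescent
  Literature.NumberTheory.EllipticCurves.RingClassField
  Summit.BirchSwinnertonDyer.BirchSwinnertonDyer.Theorems.SylvesterTwoCMData
  Summit.BirchSwinnertonDyer.BirchSwinnertonDyer.Theorems.SylvesterTwoCoupledTelescope
  Summit.BirchSwinnertonDyer.Rank1Residual.X11b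
  Summit.BirchSwinnertonDyer.Rank1Residual.X11b.RingClassTower

variable {K : Type} [Field K] [NumberField K]

/-! ## §3 The rows' Kolyvagin classes are admissible -/

set_option maxHeartbeats 3200000 in
/-- ★★ **RESIDUE c v3 l.81 / l.82 for the class system** (`Adm_X` = `𝒪`-lines of σ-eigenclasses): for every
`n ∈ KolSupp Kol`, `c_A(n) ∈ Adm_A`, and for `n ≠ 1`, `c_B(n) ∈ Adm_B` — Gross's Prop. 5.4 in the CM frame: the class of
`ψ_X(Σᵢ R(tᵢ)(tᵢ • Pt n))` is a `σ`-eigenclass up to a power of `w_X` (files (R), (F1), (F★), B-IV).  Binders = the class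
system's (`exists_classSystem_sylvesterPair`, `classSystem_flip_sylvesterPair`) plus the conjugation `c` of `K` and the
display's `φ_X`/`fn_X`; `c_B(1)` is `bottomClass_mem_admLines`.
[cite: GrossLMS1991, Prop. 5.3, Prop. 5.4] [cite: McCallumLMS1991, §4 (4)–(6), §5] [cite: HuShuYin2019, §2 Prop. 2.4, §4.1] -/
theorem kolyvaginClasses_mem_admLines_sylvesterPair {ω : K} (hω : ω ^ 2 + ω + 1 = 0) (h2 : Module.finrank ℚ K = 2)
    (ι : K →+* ℂ) (Dt : ModularParametrizationData (⟨0, 0, 1, 0, -1⟩ : WeierstrassCurve ℚ) 243)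
    {p : ℕ} (hp : p.Prime) (h9 : p % 9 = 4) (κ : ℕ) (hκ : 1 ≤ κ)
    {NA NB : ℕ} (hNA : 3 * p ∣ NA) (hNAc : (cubeSumCurve (3 * (p : ℚ) ^ 2)).conductorNorm ℤ ∣ NA)
    (hNBc : (cubeSumCurve (p : ℚ)).conductorNorm ℤ ∣ NB) (b₀ : ℕ) (Kol : ℕ → Prop)
    (hKol : ∀ ℓ, Kol ℓ ↔ (ℓ.Prime ∧ ¬ ℓ ∣ NA ∧ ¬ ℓ ∣ NB ∧ ¬ ((ℓ : ℤ) ∣ NumberField.discr K) ∧ ℓ ≠ 2 ∧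
      (Ideal.span {(ℓ : 𝓞 K)}).IsPrime ∧ FrobEqFrobInfty (cubeSumCurve (3 * (p : ℚ) ^ 2)) K (2 ^ κ * 2 ^ κ) ℓ ∧
      FrobEqFrobInfty (cubeSumCurve (p : ℚ)) K (2 ^ κ * 2 ^ κ) ℓ ∧ b₀ < ℓ))
    (emb : (m : ℕ) → (ringClassField K ι m →+* AlgebraicClosure K))
    (hemb : ∀ (m : ℕ) (k : K), emb m (algebraMap K (ringClassField K ι m) k) = algebraMap K (AlgebraicClosure K) k)
    (hcoh : ∀ (m n : ℕ) (h : ringClassField K ι m ≤ ringClassField K ι n) (x : ringClassField K ι m),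
      emb n (RingClassField.inclusion ι h x) = emb m x)
    (ιe : (n : ℕ) → (letI : DecidableEq (ringClassField K ι (9 * p * n)) := fun a b ↦ Classical.propDecidable (a = b)
      ((⟨0, 0, 1, 0, -1⟩ : WeierstrassCurve ℚ).baseChange (ringClassField K ι (9 * p * n))).toAffine.Point →+
        geomPoints ((⟨0, 0, 1, 0, -1⟩ : WeierstrassCurve ℚ).baseChange K)))
    (hιe : ∀ n P, ιe n P = Affine.Point.map (W' := (⟨0, 0, 1, 0, -1⟩ : WeierstrassCurve ℚ)) (emb (9 * p * n)).toRatAlgHom P)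
    (Nf : ℕ → Subgroup (absoluteGaloisGroup K))
    (hNf : ∀ (m : ℕ) (g : absoluteGaloisGroup K), g ∈ Nf m ↔
      ∀ x : ringClassField K ι m, (show AlgebraicClosure K ≃ₐ[K] AlgebraicClosure K from g) (emb m x) = emb m x)
    (y : (n : ℕ) → ((⟨0, 0, 1, 0, -1⟩ : WeierstrassCurve ℚ).baseChange (ringClassField K ι (9 * p * n))).toAffine.Point)
    (hy : ∀ n, n ≠ 0 → (∀ q ∈ n.primeFactors, q % 3 = 2) →
      Affine.Point.map (W' := (⟨0, 0, 1, 0, -1⟩ : WeierstrassCurve ℚ)) (ringClassField K ι (9 * p * n)).subtype.toRatAlgHom (y n) =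
        Dt.φ (heegnerTau ((n : ℤ) ^ 2 * (81 * ((p : ℤ) ^ 2 + 4 * p + 16)),
          (n : ℤ) * (-(9 * (4 * (p : ℤ) ^ 2 + 17 * p + 72))), 4 * (p : ℤ) ^ 2 + 18 * p + 81)))
    (σ : (n q : ℕ) → (ringClassField K ι (9 * p * n) ≃ₐ[ℚ] ringClassField K ι (9 * p * n)))
    (hσgen : ∀ n q, n ≠ 0 → q.Prime → ¬ q ∣ 9 * p → (Ideal.span {(q : 𝓞 K)}).IsPrime → q ∣ n → ¬ q ∣ n / q →
      Subgroup.zpowers (σ n q) = ringClassGalOver ι (9 * p * n) (9 * p * n / q))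
    (hσgal : ∀ n q, σ n q ∈ ringClassGal ι (9 * p * n))
    (κ₉ : geomPoints ((cubeSumCurve 9).baseChange K) ≃+ geomPoints ((⟨0, 0, 1, 0, -1⟩ : WeierstrassCurve ℚ).baseChange K))
    (hκG : ∀ (g : absoluteGaloisGroup K) (P : geomPoints ((cubeSumCurve 9).baseChange K)), κ₉ (g • P) = g • κ₉ P)
    (hκf : ∀ {x y : AlgebraicClosure K}
      (h : (((cubeSumCurve (9 : ℚ)).baseChange K).baseChange (AlgebraicClosure K)).toAffine.Nonsingular x y),
      ∃ h', κ₉ (Affine.Point.some x y h) = Affine.Point.some (x / 36) ((y - 108) / 216) h')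
    {vB vA : AlgebraicClosure K} (hvBc : vB ^ 3 = algebraMap ℚ (AlgebraicClosure K) ((p : ℚ) / 9))
    (hvB : vB ≠ 0) (hvAc : vA ^ 3 = algebraMap ℚ (AlgebraicClosure K) ((p : ℚ) ^ 2 / 3)) (hvA0 : vA ≠ 0)
    (hvB3 : ∀ g : absoluteGaloisGroup K, ((show AlgebraicClosure K ≃ₐ[K] AlgebraicClosure K from g) vB) ^ 3 = vB ^ 3)
    (hvA3 : ∀ g : absoluteGaloisGroup K, ((show AlgebraicClosure K ≃ₐ[K] AlgebraicClosure K from g) vA) ^ 3 = vA ^ 3)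
    {ψB : geomPoints ((cubeSumCurve 9).baseChange K) ≃+ geomPoints ((cubeSumCurve (p : ℚ)).baseChange K)}
    {ψA : geomPoints ((cubeSumCurve 9).baseChange K) ≃+ geomPoints ((cubeSumCurve (3 * (p : ℚ) ^ 2)).baseChange K)}
    (hψB : ∀ {x y : AlgebraicClosure K}
      (h : (((cubeSumCurve 9).baseChange K).baseChange (AlgebraicClosure K)).toAffine.Nonsingular x y),
      ∃ h', ψB (Affine.Point.some x y h) = Affine.Point.some (vB ^ 2 * x) (vB ^ 3 * y) h')
    (hψA : ∀ {x y : AlgebraicClosure K}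
      (h : (((cubeSumCurve 9).baseChange K).baseChange (AlgebraicClosure K)).toAffine.Nonsingular x y),
      ∃ h', ψA (Affine.Point.some x y h) = Affine.Point.some (vA ^ 2 * x) (vA ^ 3 * y) h')
    {ρ : absoluteGaloisGroup K → geomPoints ((cubeSumCurve 9).baseChange K) ≃+ geomPoints ((cubeSumCurve 9).baseChange K)}
    (hρ : ∀ (g : absoluteGaloisGroup K) {x y : AlgebraicClosure K}
        (h : (((cubeSumCurve 9).baseChange K).baseChange (AlgebraicClosure K)).toAffine.Nonsingular x y),
        ∃ h', ρ g (Affine.Point.some x y h) =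
          Affine.Point.some (((show AlgebraicClosure K ≃ₐ[K] AlgebraicClosure K from g) vB / vB) ^ 2 * x) y h')
    (hρρ : ∀ (g : absoluteGaloisGroup K) {x y : AlgebraicClosure K}
        (h : (((cubeSumCurve 9).baseChange K).baseChange (AlgebraicClosure K)).toAffine.Nonsingular x y),
        ∃ h', ρ g (ρ g (Affine.Point.some x y h)) =
          Affine.Point.some (((show AlgebraicClosure K ≃ₐ[K] AlgebraicClosure K from g) vA / vA) ^ 2 * x) y h')
    (hlawB : ∀ (g : absoluteGaloisGroup K) (P : geomPoints ((cubeSumCurve 9).baseChange K)), g • ψB P = ψB (ρ g (g • P)))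
    (hlawA : ∀ (g : absoluteGaloisGroup K) (P : geomPoints ((cubeSumCurve 9).baseChange K)),
        g • ψA P = ψA (ρ g (ρ g (g • P))))
    (N₀ : Subgroup (absoluteGaloisGroup K))
    (hN₀ : ∀ g : absoluteGaloisGroup K, g ∈ N₀ ↔
      ∀ x : ringClassField K ι (9 * p), (show AlgebraicClosure K ≃ₐ[K] AlgebraicClosure K from g) (emb (9 * p) x) = emb (9 * p) x)
    {ιt : Type} [Fintype ιt] (t : ιt → absoluteGaloisGroup K)
    (ht : Function.Bijective fun i ↦ (t i : absoluteGaloisGroup K ⧸ N₀))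
    -- the display's CM operators and their restrictions to the `4^κ`-torsion
    (φA : Isogeny ((cubeSumCurve (3 * (p : ℚ) ^ 2)).baseChange K) ((cubeSumCurve (3 * (p : ℚ) ^ 2)).baseChange K))
    (fnA : geomTorsion ((cubeSumCurve (3 * (p : ℚ) ^ 2)).baseChange K) ((2 ^ κ * 2 ^ κ : ℕ) : ℤ) →+
      geomTorsion ((cubeSumCurve (3 * (p : ℚ) ^ 2)).baseChange K) ((2 ^ κ * 2 ^ κ : ℕ) : ℤ))
    (hfnA : ∀ (g : absoluteGaloisGroup K)
      (Q : geomTorsion ((cubeSumCurve (3 * (p : ℚ) ^ 2)).baseChange K) ((2 ^ κ * 2 ^ κ : ℕ) : ℤ)),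
      fnA (ContinuousMonoidHom.id _ g • Q) = g • fnA Q)
    (hφA : ∀ (x y : AlgebraicClosure K)
      (h : (((cubeSumCurve (3 * (p : ℚ) ^ 2)).baseChange K).baseChange (AlgebraicClosure K)).toAffine.Nonsingular x y),
      ∃ h', φA (Affine.Point.some x y h) =
        Affine.Point.some (algebraMap K (AlgebraicClosure K) ω ^ 2 * x) (algebraMap K (AlgebraicClosure K) ω ^ 3 * y) h')
    (hcoeA : ∀ Q : geomTorsion ((cubeSumCurve (3 * (p : ℚ) ^ 2)).baseChange K) ((2 ^ κ * 2 ^ κ : ℕ) : ℤ),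
      ((fnA Q : geomTorsion ((cubeSumCurve (3 * (p : ℚ) ^ 2)).baseChange K) ((2 ^ κ * 2 ^ κ : ℕ) : ℤ)) :
        geomPoints ((cubeSumCurve (3 * (p : ℚ) ^ 2)).baseChange K)) = φA Q)
    (φB : Isogeny ((cubeSumCurve (p : ℚ)).baseChange K) ((cubeSumCurve (p : ℚ)).baseChange K))
    (fnB : geomTorsion ((cubeSumCurve (p : ℚ)).baseChange K) ((2 ^ κ * 2 ^ κ : ℕ) : ℤ) →+
      geomTorsion ((cubeSumCurve (p : ℚ)).baseChange K) ((2 ^ κ * 2 ^ κ : ℕ) : ℤ))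
    (hfnB : ∀ (g : absoluteGaloisGroup K) (Q : geomTorsion ((cubeSumCurve (p : ℚ)).baseChange K) ((2 ^ κ * 2 ^ κ : ℕ) : ℤ)),
      fnB (ContinuousMonoidHom.id _ g • Q) = g • fnB Q)
    (hφB : ∀ (x y : AlgebraicClosure K)
      (h : (((cubeSumCurve (p : ℚ)).baseChange K).baseChange (AlgebraicClosure K)).toAffine.Nonsingular x y),
      ∃ h', φB (Affine.Point.some x y h) =
        Affine.Point.some (algebraMap K (AlgebraicClosure K) ω ^ 2 * x) (algebraMap K (AlgebraicClosure K) ω ^ 3 * y) h')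
    (hcoeB : ∀ Q : geomTorsion ((cubeSumCurve (p : ℚ)).baseChange K) ((2 ^ κ * 2 ^ κ : ℕ) : ℤ),
      ((fnB Q : geomTorsion ((cubeSumCurve (p : ℚ)).baseChange K) ((2 ^ κ * 2 ^ κ : ℕ) : ℤ)) :
        geomPoints ((cubeSumCurve (p : ℚ)).baseChange K)) = φB Q)
    -- the conjugation of `K`
    {c : K ≃ₐ[ℚ] K} (hcω : c ω = ω ^ 2)
    -- the class system of `exists_classSystem_sylvesterPair` (its defining equations)
    (Pt : ℕ → geomPoints ((cubeSumCurve 9).baseChange K))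
    (hPt : ∀ n, Pt n = κ₉.symm (ιe n (((n.primeFactors.sort (· ≤ ·)).map fun q ↦ (σ n q, q)).foldr
        (fun b z ↦ KolyvaginOperator.derivOp (pointGalHom (⟨0, 0, 1, 0, -1⟩ : WeierstrassCurve ℚ) (ringClassField K ι (9 * p * n))) b.1 b.2 z) (y n))))
    (hLD : ∀ n, KolSupp Kol n → Pt n ∈ FixedPoints.addSubgroup (Nf (9 * p * n)) (geomPoints ((cubeSumCurve 9).baseChange K)) ∧
        (Nf (9 * p * n)).Normal ∧ (∀ h ∈ Nf (9 * p * n), (show AlgebraicClosure K ≃ₐ[K] AlgebraicClosure K from h) vB = vB) ∧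
        (∀ h ∈ N₀, ∃ a ∈ FixedPoints.addSubgroup (Nf (9 * p * n)) (geomPoints ((cubeSumCurve 9).baseChange K)),
          ((2 ^ κ * 2 ^ κ : ℕ) : ℤ) • a = h • Pt n - Pt n))
    (cA : ℕ → galH1Torsion ((cubeSumCurve (3 * (p : ℚ) ^ 2)).baseChange K) ((2 ^ κ * 2 ^ κ : ℕ) : ℤ))
    (cB : ℕ → galH1Torsion ((cubeSumCurve (p : ℚ)).baseChange K) ((2 ^ κ * 2 ^ κ : ℕ) : ℤ))
    (hcA : ∀ n, KolSupp Kol n → ∃ (hA : IsAdmissible (absoluteGaloisGroup K)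
          ((FixedPoints.addSubgroup (Nf (9 * p * n)) (geomPoints ((cubeSumCurve 9).baseChange K))).map ψA.toAddMonoidHom) ((2 ^ κ * 2 ^ κ : ℕ) : ℤ))
        (hP : ψA (∑ i, ρ (t i) (ρ (t i) (t i • Pt n))) ∈ invPoints (absoluteGaloisGroup K)
          ((FixedPoints.addSubgroup (Nf (9 * p * n)) (geomPoints ((cubeSumCurve 9).baseChange K))).map ψA.toAddMonoidHom) ((2 ^ κ * 2 ^ κ : ℕ) : ℤ)),
        cA n = kolyvaginClass ((cubeSumCurve (3 * (p : ℚ) ^ 2)).baseChange K) ((2 ^ κ * 2 ^ κ : ℕ) : ℤ)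
          (((cubeSumCurve (3 * (p : ℚ) ^ 2)).baseChange K).zsmul_geomPoints_surjective_of_charZero
            (Int.natCast_ne_zero.mpr (mul_ne_zero (pow_ne_zero κ two_ne_zero) (pow_ne_zero κ two_ne_zero))))
          hA (ψA (∑ i, ρ (t i) (ρ (t i) (t i • Pt n)))) hP)
    (hcB : ∀ n, KolSupp Kol n → n ≠ 1 → ∃ (hA : IsAdmissible (absoluteGaloisGroup K)
          ((FixedPoints.addSubgroup (Nf (9 * p * n)) (geomPoints ((cubeSumCurve 9).baseChange K))).map ψB.toAddMonoidHom) ((2 ^ κ * 2 ^ κ : ℕ) : ℤ))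
        (hP : ψB (∑ i, ρ (t i) (t i • Pt n)) ∈ invPoints (absoluteGaloisGroup K)
          ((FixedPoints.addSubgroup (Nf (9 * p * n)) (geomPoints ((cubeSumCurve 9).baseChange K))).map ψB.toAddMonoidHom) ((2 ^ κ * 2 ^ κ : ℕ) : ℤ)),
        cB n = kolyvaginClass ((cubeSumCurve (p : ℚ)).baseChange K) ((2 ^ κ * 2 ^ κ : ℕ) : ℤ)
          (((cubeSumCurve (p : ℚ)).baseChange K).zsmul_geomPoints_surjective_of_charZero
            (Int.natCast_ne_zero.mpr (mul_ne_zero (pow_ne_zero κ two_ne_zero) (pow_ne_zero κ two_ne_zero))))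
          hA (ψB (∑ i, ρ (t i) (t i • Pt n))) hP) :
    (∀ n, KolSupp Kol n → cA n ∈
      {x : galH1Torsion ((cubeSumCurve (3 * (p : ℚ) ^ 2)).baseChange K) ((2 ^ κ * 2 ^ κ : ℕ) : ℤ) |
        ∃ y, (∃ ε : ℤ, conjAct (cubeSumCurve (3 * (p : ℚ) ^ 2)) c ((2 ^ κ * 2 ^ κ : ℕ) : ℤ) y = ε • y) ∧
          x ∈ AddSubgroup.closure ({y, resH1Hom (ContinuousMonoidHom.id _) fnA hfnA y} : Set _) ∧
          y ∈ AddSubgroup.closure ({x, resH1Hom (ContinuousMonoidHom.id _) fnA hfnA x} : Set _)}) ∧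
    (∀ n, KolSupp Kol n → n ≠ 1 → cB n ∈
      {x : galH1Torsion ((cubeSumCurve (p : ℚ)).baseChange K) ((2 ^ κ * 2 ^ κ : ℕ) : ℤ) |
        ∃ y, (∃ ε : ℤ, conjAct (cubeSumCurve (p : ℚ)) c ((2 ^ κ * 2 ^ κ : ℕ) : ℤ) y = ε • y) ∧
          x ∈ AddSubgroup.closure ({y, resH1Hom (ContinuousMonoidHom.id _) fnB hfnB y} : Set _) ∧
          y ∈ AddSubgroup.closure ({x, resH1Hom (ContinuousMonoidHom.id _) fnB hfnB x} : Set _)}) := by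
  have hK := JZero.isImaginaryQuadratic_of_sq_add_self_add_one hω h2
  have hdK := JZero.discr_eq_neg_three_of_sq_add_self_add_one hω h2
  have hζ : IsPrimitiveRoot ω 3 := (JZero.exists_aut_apply_eq_sq K hω h2).1
  have hp3 : p % 3 = 1 := by omega
  have hp0 : p ≠ 0 := hp.ne_zero
  have hp0' : (p : ℚ) ≠ 0 := by exact_mod_cast hp0
  have hp2 : p ≠ 2 := by rintro rfl; norm_num at h9
  have h9p : 9 * p ≠ 0 := mul_ne_zero (by norm_num) hp0
  haveI := isElliptic_sylvesterNineMinimal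
  haveI := isGloballyMinimal_sylvesterNineMinimal
  haveI := Rank1Residual.X12.CubeSumFamilies.isElliptic_cubeSumCurve hp0'
  haveI := Rank1Residual.X12.CubeSumFamilies.isElliptic_cubeSumCurve
    (mul_ne_zero (by norm_num) (pow_ne_zero 2 hp0') : (3 * (p : ℚ) ^ 2) ≠ 0)
  have hlev : 2 ^ κ * 2 ^ κ = 2 ^ (2 * κ) := by rw [two_mul, pow_add]
  have hω3 : algebraMap K (AlgebraicClosure K) ω ^ 3 = 1 := by
    rw [← map_pow, show ω ^ 3 = 1 by linear_combination (ω - 1) * hω, map_one]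
  have hω23 : (algebraMap K (AlgebraicClosure K) ω ^ 2) ^ 3 = 1 := by
    rw [← pow_mul, mul_comm, pow_mul, hω3, one_pow]
  -- ### what `Kol q` gives for a prime `q` (as in S4b-1)
  have hKolq : ∀ q, Kol q → q.Prime ∧ q % 3 = 2 ∧ q ≠ 2 ∧ ¬ q ∣ 9 * p ∧ (Ideal.span {(q : 𝓞 K)}).IsPrime ∧
      2 ^ (2 * κ) ∣ q + 1 := by
    intro q hq
    obtain ⟨hqp, hqA, hqB, hqd, hq2, hqP, -, hFB, -⟩ := (hKol q).mp hq
    have hFB2 : FrobEqFrobInfty (cubeSumCurve (p : ℚ)) K 2 q :=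
      FrobEqFrobInfty.of_dvd (W := cubeSumCurve (p : ℚ)) (K := K) ((dvd_pow_self 2 (by omega : κ ≠ 0)).mul_right _) hFB
    obtain ⟨hq3, hqp'⟩ := mod_three_eq_two_of_clause hω h2 hp hp3 hqp hqd hFB2
    have hq9p : ¬ q ∣ 9 * p := fun h ↦ by
      rcases (Nat.Prime.dvd_mul hqp).mp h with h9' | h'
      · have : q ∣ 3 := hqp.dvd_of_dvd_pow (by norm_num at h9' ⊢; exact h9' : q ∣ 3 ^ 2)
        have := (Nat.prime_dvd_prime_iff_eq hqp Nat.prime_three).mp this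
        omega
      · exact hqp' h'
    have hkol : IsKolyvaginPrime NB (cubeSumCurve (p : ℚ)) K 2 q := ⟨hqp, hqB, hqd, hq2, hqP, hFB2⟩
    have hdvd := (IsKolyvaginPrime.pow_dvd_add_one (cubeSumCurve (p : ℚ)) Nat.prime_two hkol (M := 2 * κ) (by omega)
      (hlev ▸ hFB)).1
    exact ⟨hqp, hq3, hq2, hq9p, hqP, Int.natCast_dvd_natCast.mp (by exact_mod_cast hdvd)⟩
  -- ### the lists of generators and their properties at `n ∈ KolSupp Kol`
  have hlist : ∀ n, KolSupp Kol n →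
      (∀ a ∈ ((n.primeFactors.sort (· ≤ ·)).map fun q ↦ (σ n q, q)), a.2 ∈ n.primeFactors) ∧
      (∀ q ∈ n.primeFactors, ∃ a ∈ ((n.primeFactors.sort (· ≤ ·)).map fun q ↦ (σ n q, q)), a.2 = q) ∧
      (∀ a ∈ ((n.primeFactors.sort (· ≤ ·)).map fun q ↦ (σ n q, q)), a.2 % 3 = 2) ∧
      (∀ a ∈ ((n.primeFactors.sort (· ≤ ·)).map fun q ↦ (σ n q, q)), a.2 ≠ 2) ∧
      (∀ a ∈ ((n.primeFactors.sort (· ≤ ·)).map fun q ↦ (σ n q, q)),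
        Subgroup.zpowers a.1 = ringClassGalOver ι (9 * p * n) (9 * p * n / a.2)) ∧
      (∀ a ∈ ((n.primeFactors.sort (· ≤ ·)).map fun q ↦ (σ n q, q)), 2 ^ (2 * κ) ∣ a.2 + 1) ∧
      (∀ a ∈ ((n.primeFactors.sort (· ≤ ·)).map fun q ↦ (σ n q, q)), a.1 ∈ ringClassGal ι (9 * p * n)) := by
    rintro n ⟨hsq, hkol⟩
    have hmem : ∀ a ∈ ((n.primeFactors.sort (· ≤ ·)).map fun q ↦ (σ n q, q)), a.2 ∈ n.primeFactors ∧ a = (σ n a.2, a.2) := by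
      intro a ha
      obtain ⟨q, hq, rfl⟩ := List.mem_map.mp ha
      exact ⟨(Finset.mem_sort _).mp hq, rfl⟩
    refine ⟨fun a ha ↦ (hmem a ha).1, fun q hq ↦ ⟨(σ n q, q), List.mem_map.mpr ⟨q, (Finset.mem_sort _).mpr hq, rfl⟩, rfl⟩,
      fun a ha ↦ (hKolq _ (hkol _ (hmem a ha).1)).2.1, fun a ha ↦ (hKolq _ (hkol _ (hmem a ha).1)).2.2.1,
      fun a ha ↦ ?_, fun a ha ↦ (hKolq _ (hkol _ (hmem a ha).1)).2.2.2.2.2, fun a ha ↦ ?_⟩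
    · obtain ⟨hq, e⟩ := hmem a ha
      obtain ⟨hqp, -, -, hq9p, hqP, -⟩ := hKolq _ (hkol _ hq)
      have hqn : a.2 ∣ n := Nat.dvd_of_mem_primeFactors hq
      have hqn' : ¬ a.2 ∣ n / a.2 := fun h' ↦
        hqp.one_lt.ne' (Nat.isUnit_iff.mp (hsq _ (Nat.mul_dvd_of_dvd_div hqn h')))
      rw [e]
      exact hσgen n a.2 hsq.ne_zero hqp hq9p hqP hqn hqn'
    · obtain ⟨-, e⟩ := hmem a ha
      rw [e]
      exact hσgal n a.2
  -- ### the level data at every `n ∈ KolSupp Kol`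
  have LD := fun n (h : KolSupp Kol n) ↦
    levelData_sylvesterTower hω h2 ι Dt hp hp3 h.1 (rfl : 9 * p * n = 9 * p * n) κ₉ hκG hvBc hvB hvAc hvA0 hvB3 hvA3
      hρ hρρ hlawB hlawA (emb (9 * p)) (hemb _) N₀ hN₀ t ht
      (ringClassField_mono hK ι (dvd_mul_right (9 * p) n) (mul_ne_zero h9p h.1.ne_zero)) (emb (9 * p * n)) (hemb _)
      (fun x ↦ hcoh _ _ _ x) (ιe n) (hιe n) (Nf (9 * p * n)) (hNf _) _ (hlist n h).1 (hlist n h).2.1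
      (hlist n h).2.2.1 (hlist n h).2.2.2.1 (hlist n h).2.2.2.2.1 (2 ^ κ * 2 ^ κ) hlev (hlist n h).2.2.2.2.2.1
      (hy n h.1.ne_zero fun q hq ↦ (hKolq q (h.2 q hq)).2.1)
  -- ### the lift `τ̃` of the conjugation `c`, its restriction to `K[9p]`, `N₀`
  have hc : c ≠ 1 := conj_ne_one hω hcω
  obtain ⟨c₀, hc₀⟩ := exists_isComplexConjugation (Rat.castHom ℝ)
  have hτ : IsLiftOfAut c (absGaloisTransport (K := ℚ) (L := K) c₀).toRingEquiv :=
    RatClosure.isLiftOfAut_absGaloisTransport_of_isImaginaryQuadratic hK hc hc₀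
  have hinv : ∀ x, (absGaloisTransport (K := ℚ) (L := K) c₀).toRingEquiv
      ((absGaloisTransport (K := ℚ) (L := K) c₀).toRingEquiv x) = x := fun x ↦
    RatClosure.absGaloisTransport_absGaloisTransport_of_sq_eq_one hc₀.sq_eq_one x
  set τ := (absGaloisTransport (K := ℚ) (L := K) c₀).toRingEquiv with hτdef
  obtain ⟨τ₀, hτ₀c, -⟩ := exists_algEquiv_lift_comp hK ι h9p (emb (9 * p)) (hemb _) hτ hc
  haveI := (finiteDimensional_and_isGalois_ringClassField hK ι h9p).2
  haveI hN₀n : N₀.Normal := normal_of_mem_iff (emb (9 * p)) (hemb _) N₀ hN₀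
  have hN₀τ : ∀ h ∈ N₀, hτ.conjGalCMH h ∈ N₀ := fun h hh ↦ conjGalCMH_mem_of_lift hτ (emb (9 * p)) hτ₀c hN₀ hh
  have hτQ : ∀ q : ℚ, τ (algebraMap ℚ (AlgebraicClosure K) q) = algebraMap ℚ (AlgebraicClosure K) q := fun q ↦ by
    rw [eq_ratCast, map_ratCast]
  have hτvB : (τ vB) ^ 3 = vB ^ 3 := by rw [← map_pow, hvBc, hτQ]
  have hτvA : (τ vA) ^ 3 = vA ^ 3 := by rw [← map_pow, hvAc, hτQ]
  -- ### the twist families `ρ` (B) and `ρ ∘ ρ` (A)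
  have hRfB : ∀ g : absoluteGaloisGroup K, ∃ u : AlgebraicClosure K, u ^ 3 = 1 ∧ ∀ (x y : AlgebraicClosure K)
      (h : (((cubeSumCurve 9).baseChange K).baseChange (AlgebraicClosure K)).toAffine.Nonsingular x y),
      ∃ h', ρ g (Affine.Point.some x y h) = Affine.Point.some (u * x) y h' := fun g ↦
    ⟨_, by rw [← pow_mul, mul_comm, pow_mul, JZero.div_pow_three_eq_one hvB (hvB3 g), one_pow], fun x y h ↦ hρ g h⟩
  have hRfA : ∀ g : absoluteGaloisGroup K, ∃ u : AlgebraicClosure K, u ^ 3 = 1 ∧ ∀ (x y : AlgebraicClosure K)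
      (h : (((cubeSumCurve 9).baseChange K).baseChange (AlgebraicClosure K)).toAffine.Nonsingular x y),
      ∃ h', (fun g ↦ (ρ g).trans (ρ g)) g (Affine.Point.some x y h) = Affine.Point.some (u * x) y h' := fun g ↦
    ⟨_, by rw [← pow_mul, mul_comm, pow_mul, JZero.div_pow_three_eq_one hvA0 (hvA3 g), one_pow], fun x y h ↦ hρρ g h⟩
  have hRmulB : ∀ g g' Q, ρ (g * g') Q = ρ g (ρ g' Q) := JZero.rho_mul_apply_of_omega hω hvB hvB3 hρ
  have hρcomm : ∀ g g' Q, ρ g (ρ g' Q) = ρ g' (ρ g Q) := fun g g' Q ↦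
    eq_of_formula (F := fun Q ↦ ρ g (ρ g' Q)) (G := fun Q ↦ ρ g' (ρ g Q)) (by simp) (by simp)
      (comp_formula (F := ρ g') (G := ρ g) (formula_one_mul fun x y h ↦ hρ g' h) (formula_one_mul fun x y h ↦ hρ g h))
      (comp_formula (F := ρ g) (G := ρ g') (formula_one_mul fun x y h ↦ hρ g h) (formula_one_mul fun x y h ↦ hρ g' h))
      (mul_comm _ _) (mul_comm _ _) Q
  have hRmulA : ∀ g g' Q, (fun g ↦ (ρ g).trans (ρ g)) (g * g') Q =
      (fun g ↦ (ρ g).trans (ρ g)) g ((fun g ↦ (ρ g).trans (ρ g)) g' Q) := by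
    intro g g' Q
    simp only [AddEquiv.trans_apply]
    rw [hRmulB, hRmulB, hρcomm g' g]
  have hRconjB : ∀ g Q, ρ (hτ.conjGalCMH g) Q = ρ g (ρ g Q) := rho_conjGalCMH_eq hτ hinv hω hcω hvB hτvB hvB3 hρ
  have hRconjA : ∀ g Q, (fun g ↦ (ρ g).trans (ρ g)) (hτ.conjGalCMH g) Q =
      (fun g ↦ (ρ g).trans (ρ g)) g ((fun g ↦ (ρ g).trans (ρ g)) g Q) := by
    intro g Q
    simp only [AddEquiv.trans_apply]
    rw [hRconjB, hRconjB]
  -- ### CM data on the frame curve `E₉`: the `x`-scaling by `ω̄²`, `φ_X ∘ ψ_X = ψ_X ∘ [ω̄²]`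
  have h91 : ((cubeSumCurve (9 : ℚ)).baseChange K).a₁ = 0 := by simp [cubeSumCurve, WeierstrassCurve.baseChange]
  have h92 : ((cubeSumCurve (9 : ℚ)).baseChange K).a₂ = 0 := by simp [cubeSumCurve, WeierstrassCurve.baseChange]
  have h93 : ((cubeSumCurve (9 : ℚ)).baseChange K).a₃ = 0 := by simp [cubeSumCurve, WeierstrassCurve.baseChange]
  have h94 : ((cubeSumCurve (9 : ℚ)).baseChange K).a₄ = 0 := by simp [cubeSumCurve, WeierstrassCurve.baseChange]
  obtain ⟨S, hS⟩ := JZero.exists_mulX_addEquiv ((cubeSumCurve (9 : ℚ)).baseChange K) h91 h92 h93 h94 hω23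
  have hSψB : ∀ Q, ψB (S Q) = φB (ψB Q) := fun Q ↦
    eq_of_formula (F := fun Q ↦ ψB (S Q)) (G := fun Q ↦ φB (ψB Q)) (by simp) (by simp)
      (comp_formula (F := S) (G := ψB) (formula_one_mul fun x y h ↦ hS h) (fun x y h ↦ hψB h))
      (comp_formula (F := ψB) (G := φB) (fun x y h ↦ hψB h) hφB) (by ring) (by rw [hω3]; ring) Q
  have hSψA : ∀ Q, ψA (S Q) = φA (ψA Q) := fun Q ↦
    eq_of_formula (F := fun Q ↦ ψA (S Q)) (G := fun Q ↦ φA (ψA Q)) (by simp) (by simp)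
      (comp_formula (F := S) (G := ψA) (formula_one_mul fun x y h ↦ hS h) (fun x y h ↦ hψA h))
      (comp_formula (F := ψA) (G := φA) (fun x y h ↦ hψA h) hφA) (by ring) (by rw [hω3]; ring) Q
  obtain ⟨ρτB, hρτB⟩ := JZero.IsLiftOfAut.exists_rho (W := cubeSumCurve 9) (K := K) (τ := τ) rfl rfl rfl rfl hvB hτvB
  obtain ⟨ρτA, hρτA⟩ := JZero.IsLiftOfAut.exists_rho (W := cubeSumCurve 9) (K := K) (τ := τ) rfl rfl rfl rfl hvA0 hτvA
  have huB : ((τ vB / vB) ^ 2) ^ 3 = 1 := by rw [← pow_mul, mul_comm, pow_mul, JZero.div_pow_three_eq_one hvB hτvB, one_pow]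
  have huA : ((τ vA / vA) ^ 2) ^ 3 = 1 := by rw [← pow_mul, mul_comm, pow_mul, JZero.div_pow_three_eq_one hvA0 hτvA, one_pow]
  have hrelA : ∀ Q, fnA (fnA Q) + fnA Q + Q = 0 := JZero.torsion_hrel_of_formula
    (SylvesterTwoCoupledDescentF4Package.baseChange_eq_of_a_eq_zero (K := K) (cubeSumCurve (3 * (p : ℚ) ^ 2)) rfl rfl rfl rfl)
    hζ φA hφA _ fnA hcoeA
  have hrelB : ∀ Q, fnB (fnB Q) + fnB Q + Q = 0 := JZero.torsion_hrel_of_formula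
    (SylvesterTwoCoupledDescentF4Package.baseChange_eq_of_a_eq_zero (K := K) (cubeSumCurve (p : ℚ)) rfl rfl rfl rfl)
    hζ φB hφB _ fnB hcoeB
  -- ### per level `n`
  have main : ∀ n (hn : KolSupp Kol n),
      (cA n ∈ {x : galH1Torsion ((cubeSumCurve (3 * (p : ℚ) ^ 2)).baseChange K) ((2 ^ κ * 2 ^ κ : ℕ) : ℤ) |
        ∃ y, (∃ ε : ℤ, conjAct (cubeSumCurve (3 * (p : ℚ) ^ 2)) c ((2 ^ κ * 2 ^ κ : ℕ) : ℤ) y = ε • y) ∧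
          x ∈ AddSubgroup.closure ({y, resH1Hom (ContinuousMonoidHom.id _) fnA hfnA y} : Set _) ∧
          y ∈ AddSubgroup.closure ({x, resH1Hom (ContinuousMonoidHom.id _) fnA hfnA x} : Set _)}) ∧
      (n ≠ 1 → cB n ∈ {x : galH1Torsion ((cubeSumCurve (p : ℚ)).baseChange K) ((2 ^ κ * 2 ^ κ : ℕ) : ℤ) |
        ∃ y, (∃ ε : ℤ, conjAct (cubeSumCurve (p : ℚ)) c ((2 ^ κ * 2 ^ κ : ℕ) : ℤ) y = ε • y) ∧
          x ∈ AddSubgroup.closure ({y, resH1Hom (ContinuousMonoidHom.id _) fnB hfnB y} : Set _) ∧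
          y ∈ AddSubgroup.closure ({x, resH1Hom (ContinuousMonoidHom.id _) fnB hfnB x} : Set _)}) := by
    intro n hn
    have hn0 : n ≠ 0 := hn.1.ne_zero
    have hN0 : 9 * p * n ≠ 0 := mul_ne_zero h9p hn0
    have hq32 : ∀ q ∈ n.primeFactors, q % 3 = 2 := fun q hq ↦ (hKolq q (hn.2 q hq)).2.1
    have hn3 : ¬ 3 ∣ n := fun h ↦ by
      have := hq32 3 (Nat.mem_primeFactors.mpr ⟨Nat.prime_three, h, hn0⟩); omega
    have hnC := isCoprime_C_of_forall_prime_mod_three_eq_two (p := p) hn0 hq32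
    set A₉ := FixedPoints.addSubgroup (Nf (9 * p * n)) (geomPoints ((cubeSumCurve 9).baseChange K)) with hA₉
    haveI hNfn : (Nf (9 * p * n)).Normal := (hLD n hn).2.1
    -- the restriction of `τ̃` to `K[9pn]` and the `τ̃`-stability of `N_n`
    obtain ⟨τn, hτnc, hτn⟩ := exists_algEquiv_lift_comp hK ι hN0 (emb (9 * p * n)) (hemb _) hτ hc
    have hNfτ : ∀ h ∈ Nf (9 * p * n), hτ.conjGalCMH h ∈ Nf (9 * p * n) := fun h hh ↦
      conjGalCMH_mem_of_lift hτ (emb (9 * p * n)) hτnc (hNf _) hh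
    -- the module `A₉ = E₉(K̄)^{N_n}`: stable under `Γ_K`, `ρ`, cube-root scalings, `τ̃`
    have hAG : ∀ (g : absoluteGaloisGroup K), ∀ a ∈ A₉, g • a ∈ A₉ := fun g a ha ↦
      JZero.smul_mem_fixedPoints _ (Nf (9 * p * n)) g ha
    have hARB : ∀ g, ∀ a ∈ A₉, ρ g a ∈ A₉ := fun g a ha ↦ JZero.rho_mem_fixedPoints _ hω hvB hvB3 hρ (Nf (9 * p * n)) g ha
    have hARA : ∀ g, ∀ a ∈ A₉, (fun g ↦ (ρ g).trans (ρ g)) g a ∈ A₉ := fun g a ha ↦ hARB g _ (hARB g a ha)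
    have hAsc := fun (S' : geomPoints ((cubeSumCurve 9).baseChange K) ≃+ geomPoints ((cubeSumCurve 9).baseChange K))
      (u : AlgebraicClosure K) (hu : u ^ 3 = 1) hS' ↦ scale_mem_fixedPoints (E := cubeSumCurve 9) hω (Nf (9 * p * n)) S' u hu hS'
    have hAτ₉ : ∀ a ∈ A₉, hτ.pointsMap (cubeSumCurve 9) a ∈ A₉ := by
      intro a ha
      rw [hA₉, JZero.mem_fixedPoints_iff] at ha ⊢
      intro h hh
      rw [← hτ.pointsMap_smul (cubeSumCurve 9), ha _ (hNfτ h hh)]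
    -- the reflection input for `Pt n`
    have hrefl := exists_reflection_framePoint hK hdK ι Dt hp3 hn0 hn3 hnC (emb (9 * p * n)) (hemb _) (ιe n) (hιe n)
      (Nf (9 * p * n)) (hNf _) (hy n hn0 hq32) _ (hlist n hn).2.2.2.2.2.2 (LD n hn).2.1
      (m := ((2 ^ κ * 2 ^ κ : ℕ) : ℤ)) (fun a ha ↦ by
        rw [hlev]; exact Int.natCast_dvd_natCast.mpr ((hlist n hn).2.2.2.2.2.1 a ha)) κ₉ hκG hκf hτ hτnc hτn
    rw [← hPt n] at hrefl
    have hRN₀B : ∀ h ∈ N₀, ∀ Q, ρ h Q = Q := fun h hh Q ↦ JZero.rho_apply_of_apply_eq hvB hρ ((LD n hn).2.2.2.2.2.2.1 h hh) Q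
    have hRN₀A : ∀ h ∈ N₀, ∀ Q, (fun g ↦ (ρ g).trans (ρ g)) h Q = Q := fun h hh Q ↦ by
      simp only [AddEquiv.trans_apply]; rw [hRN₀B h hh, hRN₀B h hh]
    refine ⟨?_, fun hn1 ↦ ?_⟩
    · -- ### the `A`-side class
      obtain ⟨hA, hP, hcAn⟩ := hcA n hn
      rw [hcAn]
      have hcases := exists_reflection_chiComponent_cases (E := cubeSumCurve 9) (W' := cubeSumCurve (3 * (p : ℚ) ^ 2)) hτ hinv
        hω hcω rfl rfl rfl rfl hvA0 hτvA hψA φA.toAddMonoidHom hφA (fun g ↦ (ρ g).trans (ρ g)) hRfA hRmulA hRconjA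
        N₀ hRN₀A hN₀τ t ht A₉ hAG hARA hAsc (M := 2 * κ) (by omega) (2 ^ κ * 2 ^ κ) hlev
        (fun a ha h0 ↦ hA.eq_zero_of_zsmul ha h0) (hLD n hn).2.2.2 hrefl
      refine kolyvaginClass_mem_admLines_of_reflection_cases hτ hω hcω φA.toAddMonoidHom φA.equivariant hφA hA
        ?_ ?_ fnA hfnA hcoeA hrelA hP (by simpa only [AddEquiv.trans_apply] using hcases)
      · rintro _ ⟨a₀, ha₀, rfl⟩
        refine ⟨ρτA (hτ.pointsMap (cubeSumCurve 9) a₀), hAsc ρτA _ huA (fun x y h ↦ hρτA h) _ (hAτ₉ a₀ ha₀), ?_⟩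
        exact (JZero.IsLiftOfAut.pointsMap_cubicTwist_of_apply_eq (W := cubeSumCurve 9)
          (W' := cubeSumCurve (3 * (p : ℚ) ^ 2)) hτ hvA0 hτvA hψA hρτA a₀).symm
      · rintro _ ⟨a₀, ha₀, rfl⟩
        exact ⟨S a₀, hAsc S _ hω23 (fun x y h ↦ hS h) _ ha₀, hSψA a₀⟩
    · -- ### the `B`-side class
      obtain ⟨hA, hP, hcBn⟩ := hcB n hn hn1
      rw [hcBn]
      have hcases := exists_reflection_chiComponent_cases (E := cubeSumCurve 9) (W' := cubeSumCurve (p : ℚ)) hτ hinv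
        hω hcω rfl rfl rfl rfl hvB hτvB hψB φB.toAddMonoidHom hφB ρ hRfB hRmulB hRconjB
        N₀ hRN₀B hN₀τ t ht A₉ hAG hARB hAsc (M := 2 * κ) (by omega) (2 ^ κ * 2 ^ κ) hlev
        (fun a ha h0 ↦ hA.eq_zero_of_zsmul ha h0) (hLD n hn).2.2.2 hrefl
      refine kolyvaginClass_mem_admLines_of_reflection_cases hτ hω hcω φB.toAddMonoidHom φB.equivariant hφB hA
        ?_ ?_ fnB hfnB hcoeB hrelB hP hcases
      · rintro _ ⟨a₀, ha₀, rfl⟩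
        refine ⟨ρτB (hτ.pointsMap (cubeSumCurve 9) a₀), hAsc ρτB _ huB (fun x y h ↦ hρτB h) _ (hAτ₉ a₀ ha₀), ?_⟩
        exact (JZero.IsLiftOfAut.pointsMap_cubicTwist_of_apply_eq (W := cubeSumCurve 9)
          (W' := cubeSumCurve (p : ℚ)) hτ hvB hτvB hψB hρτB a₀).symm
      · rintro _ ⟨a₀, ha₀, rfl⟩
        exact ⟨S a₀, hAsc S _ hω23 (fun x y h ↦ hS h) _ ha₀, hSψB a₀⟩
  exact ⟨fun n hn ↦ (main n hn).1, fun n hn hn1 ↦ (main n hn).2 hn1⟩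

end Summit.BirchSwinnertonDyer.BirchSwinnertonDyer.Theorems.SylvesterTwoCMFlip

end
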